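import Summits.Parity.GeneralizedHardyLittlewood.Theorems.LeeYangFibresRelativeDimOneDefs
import Summits.Parity.GeneralizedHardyLittlewood.Theorems.LeeYangFibresRelativeDimOneTightness
import Summits.Parity.GeneralizedHardyLittlewood.Theorems.LeeYangFibresCellParityLawSingularRatio
import Literature.NumberTheory.Sieve.LinearEquationsInPrimesCrudeBounds
import Literature.NumberTheory.Sieve.LinearEquationsInPrimesSingularSeries
import Literature.NumberTheory.Sieve.GallagherSingularSeries
import Mathlib.Analysis.SpecialFunctions.Pow.Asymptotics
import Mathlib.NumberTheory.Primorial
import HarnessLib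

/-!
# Route `LeeYangFibres`, crux `RelativeDimOne` (stmt-Parity-14113), line `SketchIdeator1` =
`translate-amplification`: small facts for the glue `stub_singularMeanGlue` (part 1)

Sorry-free auxiliary facts over the vocabulary `LeeYangFibresRelativeDimOneDefs.lean`, used by
`LeeYangFibresRelativeDimOneSingularMeanGlue.lean` (Gallagher's interchange argument for the main terms
of the translate-constellations):

* `archFactor_translateFamily` — `β_∞(Ψ^{(H)}, K_H) = vol((K ∩ {Ψ > 0})_H)`;
* `meetTranslates_eq_empty_of_not_mem_shiftBox` — `I_H = ∅` off the shift box when `I ⊆ [-N, N]`;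
* volume bookkeeping (`toReal_volume_le_of_subset_realBox`, `toReal_volume_meetTranslates_le`);
* `singularProductPartial_le_pow` — the crude bound `∏_{p ≤ y} β_p(Φ) ≤ y^T`;
* the truncation level `y_N = ⌊log N / 4⌋`: `truncLevel_le_log_div`, `one_le_truncLevel`,
  `primorial_truncLevel_le_rpow` (`∏_{p ≤ y_N} p ≤ N^{(log 4)/4}`) and the decisive
  `primorial_mul_pow_truncLevel_eventually_le` (`(∏_{p ≤ y_N} p) · y_N^T ≤ η N` eventually);
* `isNondegenerateSystem_translateFamily_fin_zero` — for `m = 0` the translate-constellation is `Ψ` itself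
  (no degenerate shifts), and `pow_pred_mul_le` — the numerics `(4N+1)^{m-1} 2N ≤ 5^m N^m` for `m ≥ 1`;
* `one_sub_mul_le_pow` (Bernoulli) and `glue_algebra` — the final bookkeeping of the glue: relative
  errors `O((m+1)δ)` from the tails and absolute errors from cubes, boundary and degenerate shifts.
-/

noncomputable section

open scoped BigOperators Classical Topology
open Finset Filter MeasureTheory Literature.NumberTheory.Sieve

namespace Summit.Parity.GeneralizedHardyLittlewood.Cruxes.RelativeDimOne.TranslateAmplification

variable {t m : ℕ}

/-! ### The archimedean weight of a translate-constellation -/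

/-- `β_∞(Ψ^{(H)}, K_H) = vol(I_H)` with `I = K ∩ {x | ψ_i(x) > 0 ∀ i} = posBody Ψ 0 K`: the positivity
region of `Ψ^{(H)}` on `K_H` is the meet of the translates of the positivity region of `Ψ` on `K`. -/
theorem archFactor_translateFamily (Ψ : Fin t → AffLinForm 1) (K : Set (Fin 1 → ℝ)) (H : Fin m → ℤ) :
    archFactor (translateFamily Ψ H) (meetTranslates K H) =
      (volume (meetTranslates (posBody Ψ 0 K) H)).toReal := by
  have hset : meetTranslates K H ∩ {x | ∀ k, 0 < (translateFamily Ψ H k).realEval x} =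
      meetTranslates (posBody Ψ 0 K) H := by
    ext x
    simp only [Set.mem_inter_iff, Set.mem_setOf_eq, meetTranslates, posBody]
    constructor
    · rintro ⟨hK, hpos⟩ j
      refine ⟨hK j, fun i => ?_⟩
      have := hpos (finProdFinEquiv (j, i))
      rwa [translateFamily_apply, translateForm_realEval] at this
    · intro h
      refine ⟨fun j => (h j).1, fun k => ?_⟩
      obtain ⟨⟨j, i⟩, rfl⟩ := finProdFinEquiv.surjective k
      rw [translateFamily_apply, translateForm_realEval]
      exact (h j).2 i
  unfold archFactor
  rw [hset]

/-- Off the shift box the meet of translates of a set `I ⊆ [-N, N]` is empty (`x, x + H_j ∈ [-N, N]`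
forces `|H_j| ≤ 2N`). -/
theorem meetTranslates_eq_empty_of_not_mem_shiftBox {I : Set (Fin 1 → ℝ)} {N : ℕ}
    (hI : I ⊆ realBox 1 N) {H : Fin m → ℤ} (hH : H ∉ shiftBox m N) : meetTranslates I H = ∅ := by
  rw [shiftBox, Fintype.mem_piFinset] at hH
  push Not at hH
  obtain ⟨j, hj⟩ := hH
  rw [Finset.mem_Icc, not_and_or, not_le, not_le] at hj
  ext x
  simp only [Set.mem_empty_iff_false, iff_false]
  intro hx
  have h0 := hI (hx 0)
  have hj' := hI (hx j.succ)
  simp only [shiftVec_zero, shiftVec_succ, Int.cast_zero, add_zero, realBox, Set.mem_Icc,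
    Pi.le_def] at h0 hj'
  have h0l := h0.1 0
  have h0u := h0.2 0
  have hjl := hj'.1 0
  have hju := hj'.2 0
  rcases hj with hj | hj
  · have : ((H j : ℤ) : ℝ) < -(2 * (N : ℝ)) := by exact_mod_cast hj
    linarith
  · have : (2 * (N : ℝ)) < ((H j : ℤ) : ℝ) := by exact_mod_cast hj
    linarith

/-- Hence the archimedean weight `vol(I_H)` vanishes off the shift box. -/
theorem toReal_volume_meetTranslates_eq_zero {I : Set (Fin 1 → ℝ)} {N : ℕ} (hI : I ⊆ realBox 1 N)
    {H : Fin m → ℤ} (hH : H ∉ shiftBox m N) : (volume (meetTranslates I H)).toReal = 0 := by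
  rw [meetTranslates_eq_empty_of_not_mem_shiftBox hI hH, measure_empty, ENNReal.toReal_zero]

/-- A subset of the box `[-N, N] ⊆ ℝ¹` has finite volume, at most `2N`. -/
theorem toReal_volume_le_of_subset_realBox {I : Set (Fin 1 → ℝ)} {N : ℕ} (hI : I ⊆ realBox 1 N) :
    (volume I).toReal ≤ 2 * N ∧ volume I ≠ ⊤ := by
  have hbox : volume (realBox 1 (N : ℝ)) = ENNReal.ofReal (2 * N) := by
    rw [realBox, Real.volume_Icc_pi, Fin.prod_univ_one]
    congr 1
    ring
  have hle : volume I ≤ ENNReal.ofReal (2 * N) := hbox ▸ measure_mono hI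
  exact ⟨ENNReal.toReal_le_of_le_ofReal (by positivity) hle,
    ne_top_of_le_ne_top ENNReal.ofReal_ne_top hle⟩

/-- The weights `w(H) = vol(I_H)` lie in `[0, vol(I)]`. -/
theorem toReal_volume_meetTranslates_le {I : Set (Fin 1 → ℝ)} {N : ℕ} (hI : I ⊆ realBox 1 N)
    (H : Fin m → ℤ) : (volume (meetTranslates I H)).toReal ≤ (volume I).toReal :=
  ENNReal.toReal_mono (toReal_volume_le_of_subset_realBox hI).2
    (measure_mono (meetTranslates_subset I H))

/-! ### The crude bound for truncated singular products -/

/-- `∏_{p ≤ y} β_p(Φ) ≤ y^s` for a system of `s` forms and `y ≥ 1`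
(`β_p ≤ (p/(p-1))^s = (1 - 1/p)^{-s}` and `∏_{p ≤ y} (1 - 1/p)^{-1} ≤ y`). -/
theorem singularProductPartial_le_pow {d s : ℕ} (Φ : Fin s → AffLinForm d) {y : ℕ} (hy : 1 ≤ y) :
    singularProductPartial Φ y ≤ (y : ℝ) ^ s := by
  have hfac : ∀ p ∈ Nat.primesLE y, 0 ≤ (1 - 1 / (p : ℝ))⁻¹ := fun p hp => by
    have hp' := (Nat.mem_primesLE.1 hp).2
    have hp0 : (0 : ℝ) < p := by exact_mod_cast hp'.pos
    rw [inv_nonneg, sub_nonneg, div_le_one hp0]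
    exact_mod_cast hp'.one_le
  unfold singularProductPartial
  calc ∏ p ∈ Nat.primesLE y, localFactor Φ p
      ≤ ∏ p ∈ Nat.primesLE y, (1 - 1 / (p : ℝ))⁻¹ ^ s := by
        refine Finset.prod_le_prod (fun p _ => localFactor_nonneg Φ p) fun p hp => ?_
        have hp' := (Nat.mem_primesLE.1 hp).2
        have hp0 : (0 : ℝ) < p := by exact_mod_cast hp'.pos
        rw [one_sub_div hp0.ne', inv_div]
        exact localFactor_prime_le Φ hp'
    _ = (∏ p ∈ Nat.primesLE y, (1 - 1 / (p : ℝ))⁻¹) ^ s := Finset.prod_pow _ _ _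
    _ ≤ (y : ℝ) ^ s :=
        pow_le_pow_left₀ (Finset.prod_nonneg hfac) (Gallagher.prod_primesLE_inv_le y hy) s

/-! ### The truncation level and the primorial -/

/-- `y_N ≤ log N / 4` for `N ≥ 1`. -/
theorem truncLevel_le_log_div : ∀ N : ℕ, 1 ≤ N → (truncLevel N : ℝ) ≤ Real.log N / 4 := by
  intro N hN
  unfold truncLevel
  refine Nat.floor_le ?_
  have := Real.log_nonneg (show (1 : ℝ) ≤ N by exact_mod_cast hN)
  positivity

/-- `y_N ≥ 1` once `N ≥ e^4`. -/
theorem one_le_truncLevel {N : ℕ} (hN : Real.exp 4 ≤ N) : 1 ≤ truncLevel N := by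
  unfold truncLevel
  refine Nat.le_floor ?_
  have hN0 : (0 : ℝ) < N := lt_of_lt_of_le (Real.exp_pos 4) hN
  have : (4 : ℝ) ≤ Real.log N := by
    rw [Real.le_log_iff_exp_le hN0]
    exact hN
  push_cast
  linarith

/-- `∏_{p ≤ y_N} p ≤ 4^{y_N} ≤ N^{(log 4)/4}` (Mathlib's `primorial_le_four_pow`). -/
theorem primorial_truncLevel_le_rpow {N : ℕ} (hN : 1 ≤ N) :
    ((primorial (truncLevel N) : ℕ) : ℝ) ≤ (N : ℝ) ^ (Real.log 4 / 4 : ℝ) := by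
  have hN0 : (0 : ℝ) < N := by exact_mod_cast hN
  have h1 : ((primorial (truncLevel N) : ℕ) : ℝ) ≤ (4 : ℝ) ^ (truncLevel N) := by
    exact_mod_cast primorial_le_four_pow (truncLevel N)
  refine h1.trans ?_
  rw [Real.rpow_def_of_pos hN0, ← Real.rpow_natCast,
    Real.rpow_def_of_pos (by norm_num : (0 : ℝ) < 4)]
  refine Real.exp_le_exp.mpr ?_
  have hy := truncLevel_le_log_div N hN
  have hl4 : 0 ≤ Real.log 4 := Real.log_nonneg (by norm_num)
  nlinarith

/-- **The decisive size estimate**: `(∏_{p ≤ y_N} p) · y_N^T ≤ η N` for all large `N`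
(`∏_{p ≤ y_N} p ≤ N^{(log 4)/4}`, `(log 4)/4 < 3/4`, and `log^T N = o(N^{1/4})`). -/
theorem primorial_mul_pow_truncLevel_eventually_le (T : ℕ) {η : ℝ} (hη : 0 < η) :
    ∀ᶠ N : ℕ in atTop,
      ((primorial (truncLevel N) : ℕ) : ℝ) * (truncLevel N : ℝ) ^ T ≤ η * N := by
  set a : ℝ := Real.log 4 / 4 with ha
  have ha1 : a < 3 / 4 := by
    have := Real.log_lt_sub_one_of_pos (by norm_num : (0 : ℝ) < 4) (by norm_num)
    rw [ha]
    linarith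
  have h := (isLittleO_log_rpow_rpow_atTop (T : ℝ) (by linarith : (0 : ℝ) < 1 - a)).bound hη
  filter_upwards [tendsto_natCast_atTop_atTop.eventually h, eventually_ge_atTop 1] with N hN hN1
  have hN0 : (0 : ℝ) < N := by exact_mod_cast hN1
  have hlog0 : 0 ≤ Real.log N := Real.log_nonneg (by exact_mod_cast hN1)
  rw [Real.norm_of_nonneg (Real.rpow_nonneg hlog0 _),
    Real.norm_of_nonneg (Real.rpow_nonneg hN0.le _), Real.rpow_natCast] at hN
  have hy : (truncLevel N : ℝ) ^ T ≤ Real.log N ^ T := by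
    refine pow_le_pow_left₀ (Nat.cast_nonneg _) ?_ T
    have := truncLevel_le_log_div N hN1
    linarith
  have hP := primorial_truncLevel_le_rpow hN1
  calc ((primorial (truncLevel N) : ℕ) : ℝ) * (truncLevel N : ℝ) ^ T
      ≤ (N : ℝ) ^ a * (η * (N : ℝ) ^ (1 - a)) :=
        mul_le_mul hP (hy.trans hN) (by positivity) (by positivity)
    _ = η * N := by
        rw [mul_left_comm, ← Real.rpow_add hN0, show a + (1 - a) = 1 by ring, Real.rpow_one]

/-! ### The case `m = 0` -/

/-- For `m = 0` there are no shifts: every form of `Ψ^{(H)}` is a form of `Ψ` (with the same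
index map `k ↦ i`, injective), so `Ψ^{(H)}` is non-degenerate when `Ψ` is. -/
theorem isNondegenerateSystem_translateFamily_fin_zero {Ψ : Fin t → AffLinForm 1}
    (hΨ : IsNondegenerateSystem Ψ) (H : Fin 0 → ℤ) :
    IsNondegenerateSystem (translateFamily Ψ H) := by
  have hzero : ∀ j : Fin (0 + 1), shiftVec H j = 0 := fun j => by
    rw [Fin.fin_one_eq_zero j]
    exact shiftVec_zero H
  have heval : ∀ (k : Fin ((0 + 1) * t)) (n : Fin 1 → ℤ),
      (translateFamily Ψ H k).eval n = (Ψ (finProdFinEquiv.symm k).2).eval n := by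
    intro k n
    show (translateForm _ _).eval n = _
    rw [translateForm_eval, hzero]
    simp
  refine ⟨fun k => hΨ.1 (finProdFinEquiv.symm k).2, fun k k' hkk' a b hab => ?_⟩
  have hne : (finProdFinEquiv.symm k).2 ≠ (finProdFinEquiv.symm k').2 := by
    intro h
    apply hkk'
    apply finProdFinEquiv.symm.injective
    exact Prod.ext (by rw [Fin.fin_one_eq_zero (finProdFinEquiv.symm k).1,
      Fin.fin_one_eq_zero (finProdFinEquiv.symm k').1]) h
  exact hΨ.2 _ _ hne a b fun n => by rw [← heval k n, ← heval k' n]; exact hab n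

/-- Hence for `m = 0` no shift is degenerate. -/
theorem filter_not_nondegenerate_eq_empty {Ψ : Fin t → AffLinForm 1} (hΨ : IsNondegenerateSystem Ψ)
    (N : ℕ) (hm : m = 0) :
    (shiftBox m N).filter (fun H => ¬ IsNondegenerateSystem (translateFamily Ψ H)) = ∅ := by
  subst hm
  refine Finset.filter_eq_empty_iff.mpr fun H _ h => h ?_
  exact isNondegenerateSystem_translateFamily_fin_zero hΨ H

/-- The numerics of the degenerate shifts for `m ≥ 1`: `(4N+1)^{m-1} · 2N ≤ 5^m N^m` (`N ≥ 1`). -/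
theorem pow_pred_mul_le {m N : ℕ} (hm : 1 ≤ m) (hN : 1 ≤ N) :
    ((4 * N + 1 : ℕ) : ℝ) ^ (m - 1) * (2 * N) ≤ 5 ^ m * (N : ℝ) ^ m := by
  obtain ⟨k, rfl⟩ : ∃ k, m = k + 1 := ⟨m - 1, by omega⟩
  rw [Nat.add_sub_cancel, ← mul_pow, pow_succ]
  have hN1 : (1 : ℝ) ≤ N := by exact_mod_cast hN
  have h1 : ((4 * N + 1 : ℕ) : ℝ) ≤ 5 * N := by push_cast; linarith
  have h2 : ((4 * N + 1 : ℕ) : ℝ) ^ k ≤ (5 * (N : ℝ)) ^ k := pow_le_pow_left₀ (by positivity) h1 k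
  have h3 : (2 : ℝ) * N ≤ 5 * N := by linarith
  exact mul_le_mul h2 h3 (by positivity) (by positivity)

/-! ### The final bookkeeping -/

/-- Bernoulli's inequality in the form `1 - n δ ≤ (1 - δ)^n` for `0 ≤ δ ≤ 1`. -/
theorem one_sub_mul_le_pow : ∀ (n : ℕ) (δ : ℝ), 0 ≤ δ → δ ≤ 1 → 1 - n * δ ≤ (1 - δ) ^ n := by
  intro n δ _ hδ1
  have := one_add_mul_le_pow (a := -δ) (by linarith) n
  rw [show (1 : ℝ) + -δ = 1 - δ by ring] at this
  linarith

/-- **The bookkeeping of the glue.** With `B = S_box − D` (non-degenerate part of the truncated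
sum), `|A − B| ≤ δ B` (tails of the translate-constellations), `|S_box − F₀^{m+1} W_box| ≤ E₁`
(cubes), `|W_box − V^{m+1}| ≤ E₃` (archimedean sum), `0 ≤ D ≤ E₄` (degenerate shifts),
`|𝔖 − F₀| ≤ δ F₀` (tail of `Ψ`), `2(m+1)δ ≤ 1` and `F₀^{m+1} ≤ Y`:
`|A − (V 𝔖)^{m+1}| ≤ 4(m+1)δ (V 𝔖)^{m+1} + 2 (Y E₃ + E₁ + E₄)`
(Bernoulli: `(1−δ)^{m+1} ≥ 1 − (m+1)δ`, so `|F₀^{m+1} − 𝔖^{m+1}| ≤ 2(m+1)δ 𝔖^{m+1}`). -/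
theorem glue_algebra {m : ℕ} {A B Sbox Wbox DD F0 S0 V δ E1 E3 E4 Y : ℝ}
    (hB : B = Sbox - DD) (h1 : |A - B| ≤ δ * B)
    (h2 : |Sbox - F0 ^ (m + 1) * Wbox| ≤ E1) (h3 : |Wbox - V ^ (m + 1)| ≤ E3)
    (h4 : 0 ≤ DD ∧ DD ≤ E4) (h5 : |S0 - F0| ≤ δ * F0)
    (hF0 : 0 ≤ F0) (hV : 0 ≤ V) (hδ0 : 0 ≤ δ) (hδ1 : 2 * (m + 1) * δ ≤ 1)
    (hFY : F0 ^ (m + 1) ≤ Y) :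
    |A - (V * S0) ^ (m + 1)| ≤
      4 * (m + 1) * δ * (V * S0) ^ (m + 1) + 2 * (Y * E3 + E1 + E4) := by
  have hm0 : (0 : ℝ) ≤ m := Nat.cast_nonneg m
  have hmd : (m + 1) * δ ≤ 1 / 2 := by linarith
  have hmδ : 0 ≤ (m : ℝ) * δ := mul_nonneg hm0 hδ0
  have hδhalf : δ ≤ 1 / 2 := by linarith
  have h5' := abs_le.mp h5
  have h1δ : 0 ≤ 1 - δ := by linarith
  have h1δF : 0 ≤ (1 - δ) * F0 := mul_nonneg h1δ hF0
  have hS0 : 0 ≤ S0 := by linarith [h5'.1]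
  -- Bernoulli
  have hbern : 1 - (m + 1) * δ ≤ (1 - δ) ^ (m + 1) := by
    have := one_sub_mul_le_pow (m + 1) δ hδ0 (by linarith)
    push_cast at this
    linarith
  set Fp := F0 ^ (m + 1) with hFp
  set Sp := S0 ^ (m + 1) with hSp
  set Vp := V ^ (m + 1) with hVp
  have hFp0 : 0 ≤ Fp := pow_nonneg hF0 _
  have hSp0 : 0 ≤ Sp := pow_nonneg hS0 _
  have hVp0 : 0 ≤ Vp := pow_nonneg hV _
  -- `(1 - (m+1)δ) 𝔖^{m+1} ≤ F₀^{m+1}` and `(1 - (m+1)δ) F₀^{m+1} ≤ 𝔖^{m+1}`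
  have hlow : (1 - (m + 1) * δ) * Sp ≤ Fp := by
    have a1 : (1 - δ) * S0 ≤ (1 - δ) * ((1 + δ) * F0) :=
      mul_le_mul_of_nonneg_left (by linarith [h5'.2]) h1δ
    have a2 : 0 ≤ δ ^ 2 * F0 := by positivity
    have hle : (1 - δ) * S0 ≤ F0 := by nlinarith
    have := pow_le_pow_left₀ (mul_nonneg h1δ hS0) hle (m + 1)
    rw [mul_pow] at this
    calc (1 - (m + 1) * δ) * Sp ≤ (1 - δ) ^ (m + 1) * Sp := mul_le_mul_of_nonneg_right hbern hSp0
      _ ≤ Fp := this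
  have hupp : (1 - (m + 1) * δ) * Fp ≤ Sp := by
    have hle : (1 - δ) * F0 ≤ S0 := by linarith [h5'.1]
    have := pow_le_pow_left₀ h1δF hle (m + 1)
    rw [mul_pow] at this
    calc (1 - (m + 1) * δ) * Fp ≤ (1 - δ) ^ (m + 1) * Fp := mul_le_mul_of_nonneg_right hbern hFp0
      _ ≤ Sp := this
  have hmd0 : (0 : ℝ) ≤ (m + 1) * δ := by positivity
  have hmdS : 0 ≤ (m + 1) * δ * Sp := mul_nonneg hmd0 hSp0
  have hFp2 : Fp ≤ 2 * Sp := by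
    have : 0 ≤ (1 / 2 - (m + 1) * δ) * Fp := mul_nonneg (by linarith) hFp0
    linarith
  have hkey : |Fp - Sp| ≤ 2 * (m + 1) * δ * Sp := by
    rw [abs_le]
    constructor
    · linarith
    · have := mul_le_mul_of_nonneg_left hFp2 hmd0
      linarith
  -- absolute errors
  have hE3 : 0 ≤ E3 := (abs_nonneg _).trans h3
  have hBFV : |B - Fp * Vp| ≤ Y * E3 + E1 + E4 := by
    have e : B - Fp * Vp = (Sbox - Fp * Wbox) + Fp * (Wbox - Vp) - DD := by
      rw [hB]
      ring
    rw [e]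
    calc |Sbox - Fp * Wbox + Fp * (Wbox - Vp) - DD|
        ≤ |Sbox - Fp * Wbox + Fp * (Wbox - Vp)| + |DD| := abs_sub _ _
      _ ≤ (|Sbox - Fp * Wbox| + |Fp * (Wbox - Vp)|) + |DD| := by
          gcongr
          exact abs_add_le _ _
      _ ≤ (E1 + Y * E3) + E4 := by
          gcongr
          · rw [abs_mul, abs_of_nonneg hFp0]
            calc Fp * |Wbox - Vp| ≤ Fp * E3 := mul_le_mul_of_nonneg_left h3 hFp0
              _ ≤ Y * E3 := mul_le_mul_of_nonneg_right hFY hE3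
          · rw [abs_of_nonneg h4.1]
            exact h4.2
      _ = Y * E3 + E1 + E4 := by ring
  have hMp : (V * S0) ^ (m + 1) = Vp * Sp := by rw [mul_pow]
  rw [hMp]
  have hMS : 0 ≤ Vp * Sp := mul_nonneg hVp0 hSp0
  have hFVM : |Fp * Vp - Vp * Sp| ≤ 2 * (m + 1) * δ * (Vp * Sp) := by
    rw [show Fp * Vp - Vp * Sp = Vp * (Fp - Sp) by ring, abs_mul, abs_of_nonneg hVp0]
    calc Vp * |Fp - Sp| ≤ Vp * (2 * (m + 1) * δ * Sp) := mul_le_mul_of_nonneg_left hkey hVp0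
      _ = 2 * (m + 1) * δ * (Vp * Sp) := by ring
  set Eabs := Y * E3 + E1 + E4 with hEabs
  have hEabs0 : 0 ≤ Eabs := (abs_nonneg _).trans hBFV
  have hBle : B ≤ 2 * (Vp * Sp) + Eabs := by
    have hb := (abs_le.mp hBFV).2
    have hc := mul_le_mul_of_nonneg_right hFp2 hVp0
    linarith
  have htri : |A - Vp * Sp| ≤ |A - B| + |B - Fp * Vp| + |Fp * Vp - Vp * Sp| := by
    have := abs_sub_le A B (Vp * Sp)
    have := abs_sub_le B (Fp * Vp) (Vp * Sp)
    linarith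
  have hδB : δ * B ≤ δ * (2 * (Vp * Sp) + Eabs) := mul_le_mul_of_nonneg_left hBle hδ0
  have hδE : δ * Eabs ≤ Eabs := mul_le_of_le_one_left hEabs0 (by linarith)
  have hδM : δ * (Vp * Sp) ≤ (m + 1) * δ * (Vp * Sp) := by
    have : 0 ≤ (m : ℝ) * δ * (Vp * Sp) := mul_nonneg hmδ hMS
    linarith
  linarith

end Summit.Parity.GeneralizedHardyLittlewood.Cruxes.RelativeDimOne.TranslateAmplification
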